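import Summits.AtomisticToContinuum.HydrodynamicLimit.Theorems.CollisionIsometryCLTCollisionalTransferLocalityDefs
import HarnessLib

/-!
# Audit lemmas for stub `stub_thermodynamicVirial` ([B], line hemisphere-affine-slaving, crux 9518)

Sorry-free bookkeeping facts found during the statement audit of [B] `ThermoVirial`
(stub worker of the lead prover-line-stmt-AtomisticToContinuum-9518-0), landed `--supports` the crux as
the registered helper `eulerW_mul_pcoll_add_kinW_mul_pcoll`: they certify that [B] is EXACTLY the
non-equilibrium mesoscopic virial theorem "collisional-pressure measure `p_N` = `p_c(ρ̄, θ̄) ds dx`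
against the block weight `3·affW`", with no junk discrepancy from the guard of `affW`
(see the census `Cruxes/CollisionalTransferLocality/Lines/hemisphere-affine-slaving.thermoVirial.md`):

* `pcoll_eq` : `p_c(σ; r, θ) = r θ · (r σ³) · f_ex'(r σ³)` (so `p_c = pkin · η · deriv f_ex η`);
* `pcoll_rhoB_thetaB_eq` : at the block fields, `p_c(ρ̄, θ̄) = pkin · (ρ̄σ³ · f_ex'(ρ̄σ³))`;
* `pcoll_eq_zero_of_pkin_eq_zero` : the guard of `affW` is EXACTLY matched by the right-hand side:
  on a block with `pkin = ρ̄ θ̄ = 0` the collisional pressure `p_c(ρ̄, θ̄)` vanishes;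
* `eulerW_mul_pcoll_add_kinW_mul_pcoll` : pointwise `eulerW·p_c + kinW·p_c = 3·affW·p_c`, i.e. the
  integrands of `Rhs + Kfun` add up to the collisional pressure tested against `3·affW` with NO junk
  discrepancy from the guard (audit item (a) of the brief).
-/

namespace Summit.AtomisticToContinuum.HydrodynamicLimit.Theorems.HemisphereAffineSlaving

open scoped BigOperators Topology Classical MeasureTheory ENNReal
open Filter Set Function MeasureTheory

noncomputable section

open Literature.MathematicalPhysics.KineticTheory (T3 V3)

/-- `p_c(σ; r, θ) = r θ (Z(rσ³) − 1) = r θ · rσ³ · f_ex'(rσ³)`. [folklore] -/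
theorem pcoll_eq (σ r th : ℝ) :
    pcoll σ r th = r * th * (r * σ ^ 3 *
      deriv Literature.MathematicalPhysics.KineticTheory.hsExcessFreeEnergy (r * σ ^ 3)) := by
  simp only [pcoll, Literature.MathematicalPhysics.KineticTheory.hsPressure,
    Literature.MathematicalPhysics.KineticTheory.hsCompressibility]
  ring

/-- At the block fields: `p_c(ρ̄, θ̄) = pkin · (ρ̄σ³ f_ex'(ρ̄σ³))`. [folklore] -/
theorem pcoll_rhoB_thetaB_eq (σ : ℝ) (φ : ℕ → T3 → ℝ) (N : ℕ) (z : Cfg N) (x : T3) :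
    pcoll σ (rhoB φ N z x) (thetaB φ N z x) = pkin φ N z x * (rhoB φ N z x * σ ^ 3 *
      deriv Literature.MathematicalPhysics.KineticTheory.hsExcessFreeEnergy (rhoB φ N z x * σ ^ 3)) := by
  rw [pcoll_eq, pkin]

/-- The guard of `affW` is matched by the right-hand side: `pkin = 0 → p_c(ρ̄, θ̄) = 0`. [folklore] -/
theorem pcoll_eq_zero_of_pkin_eq_zero {σ : ℝ} {φ : ℕ → T3 → ℝ} {N : ℕ} {z : Cfg N} {x : T3}
    (h : pkin φ N z x = 0) : pcoll σ (rhoB φ N z x) (thetaB φ N z x) = 0 := by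
  rw [pcoll_rhoB_thetaB_eq, h, zero_mul]

/-- Pointwise, the integrands of `Rhs` and `Kfun` add up to `3 · affW · p_c` — on guarded blocks
(`pkin = 0`) both sides vanish, elsewhere `affW = (eulerW + kinW)/3`. [folklore] -/
theorem eulerW_mul_pcoll_add_kinW_mul_pcoll : ∀ (σ : ℝ) (ψ : ℝ → T3 → V3) (χ : ℝ → T3 → ℝ) (φ : ℕ → T3 → ℝ) (N : ℕ) (s : ℝ) (z : Cfg N) (x : T3), eulerW ψ χ φ N s z x * pcoll σ (rhoB φ N z x) (thetaB φ N z x) + kinW ψ χ φ N s z x * pcoll σ (rhoB φ N z x) (thetaB φ N z x) = 3 * affW ψ χ φ N s z x * pcoll σ (rhoB φ N z x) (thetaB φ N z x) := by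
  intro σ ψ χ φ N s z x
  unfold affW
  split_ifs with h
  · rw [pcoll_eq_zero_of_pkin_eq_zero h]
    ring
  · ring

end

end Summit.AtomisticToContinuum.HydrodynamicLimit.Theorems.HemisphereAffineSlaving
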